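import Summits.QuantumFields.BalabanUV.Beta.FP.StationarityJ
import Summits.QuantumFields.BalabanUV.Beta.FP.StationarityK

/-!
# `BalabanUV.Beta.FP.StationarityJLimit` — road «FP» for binder row D1, leaf N1-J AT THE LIMIT: the PERFECT first-order jets of the
# `(m+2)`-fold step, decimated once and driven through the LIMIT one-step minimiser response, ARE the perfect jets of the `(m+1)`-fold step
# — the fixed-point property of `SPerfOf … (StationarityJ.SDec …)`, from the exact finite-level nesting `StationarityJ.SDec_succ_level` by an
# INDEX SHIFT under the constructed limit (unconditional), the units algebra, and DOMINATED CONVERGENCE of the transport superposition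
# (Tannery; hypotheses = entrywise convergence with `j`-uniform majorants, X1/X1m currency — never assumed away)

HONEST FRAMING (cell contract, verbatim): «discharging `BetaPertH` makes Bałaban's UV stability UNCONDITIONAL — a real constructive-QFT
result; it is NOT the continuum limit and NOT the Clay problem.»  THIS MODULE DISCHARGES NOTHING: [folklore] plumbing about the constructed
entrywise limits (`HessKerDressedLimit.limStOf` = `limUnder atTop` entry by entry), the leg units (`HessKerDressedUnits.unitS/counitK`), an4's
decimation `dec` and an2's response transport `transportV`, composed BY NAME with `FP/StationarityJ.SDec_succ_level` (p209042), leaf-06's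
`FP/StationarityK` §1–§2 (p208028) and Mathlib's `tendsto_tsum_of_dominated_convergence`.  Skeleton `HOME/beta/skeletons/D1-b2b-balaban-beta-d1-p3.md`
§3 N1 («passing to j → ∞ … `SPerfOf … (m+1)` decimated once = `SPerfOf … m` in shifted units»); claim table `LEAVES-FP.md` row N1-J (unit
`b2b-balaban-beta-d1-formalise-leaf-08`).  NOT BetaPertH, NOT continuum, NOT Clay.
HONEST DEPENDENCY (verbatim): «continuum YM on T⁴ ⇐ BetaPertH ∧ nine spine estimates (0/9 proved); BetaPertH ⇐ (D1) ∧ (D4) ∧ CAP+tail;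
G-an2-4 gates asym, D1 and NE2/3/4.»
ABSOLUTE RULE (cell, verbatim): «No internally-minted statement may enter as a cited fact. Every hypothesis is either kernel-proved in this
package or a verbatim quotation of a PUBLISHED theorem with page reference.»  Nothing is cited; no `def … : Prop`; no `def` at all.

CONTENT (all [folklore]).
* §1 UNITS: `scaleK_smul`, `counitK_mul` (contragredient units compose), **`unitS_mul`** (`unitS (rf·sf) (rm·sm) S κ u = (rf·rm)⁻¹ • counitK rf rm
  (unitS sf sm S κ u)`), `transportV_scaleK` (leg-type-constant units pass through the transport), `transportV_indep` (the transport's value does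
  not depend on the bookkeeping blocking `N`, `cwsum_apply`), `abs_dec_apply_le` (decimation is an average: entry bounds are preserved).
* §2 THE FINITE-LEVEL NESTING IN UNITS (geometric units `sf (j+1) = rf·sf j`, `sm (j+1) = rm·sm j`): **`unitS_SDec_succ_level`** —
  `unitS (sf (j+1)) (sm (j+1)) (SDec (j+1) m) κ u = (Lc^{d+2}·(rf·rm)⁻¹) • transportV (Lc^j) (respStep (Lc^j) (Lc^(j+1)))
     (fun κ′ u′ => counitK rf rm (dec Lc (unitS (sf j) (sm j) (SDec j (m+1)) κ′ u′))) κ u`.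
* §3 TANNERY FOR THE TRANSPORT: `tendsto_transportV_apply` — if the weights converge pointwise under a `j`-uniform summable majorant and the
  transported family converges entrywise under a `j`-uniform bound, the transport converges entrywise (`tendsto_tsum_of_dominated_convergence`).
* §4 **`SPerfOf_SDec_succ` (N1-J AT THE LIMIT)**: under (HR) pointwise convergence `respStep (Lc^j) (Lc^(j+1)) → ρ∞` with a `j`-uniform
  summable majorant (the step resolvent's `ℋ`-column in sum normalisation — X1 currency: with units `sf j·sm j = s₀·(Lc^j)^{d+2}` it IS
  `s₀⁻¹·` the `(inl, inr)` entry of `unitK (sf j) (sm j) (KInvStep Lc j)`, `respStep_eq`) and (HU) entrywise convergence of the unit-rescaled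
  (j, m+1) family with a `j`-uniform entry bound:
  `SPerfOf sf sm SDec m κ u = (Lc^{d+2}·(rf·rm)⁻¹) • transportV 1 ρ∞ (fun κ′ u′ => counitK rf rm (dec Lc (SPerfOf sf sm SDec (m+1) κ′ u′))) κ u`
  — the perfect jets NEST: the `(m+2)`-fold perfect jets, decimated once, re-read in the next units and driven through the LIMIT one-step
  response, are the `(m+1)`-fold perfect jets.  The convergence of the LESS decimated family is the hypothesis (X1m), that of the transported one
  is DERIVED inside.
* §5 (HR) IN THE ROAD'S OWN CURRENCY (matched units `sf j·sm j = s₀·(Lc^j)^{d+2}`): `respStep_eq_unitK_KInvStep` (the response IS `s₀⁻¹·`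
  the `(inl,inr)` entry of `unitK (sf j) (sm j) (KInvStep Lc j)`), `tendsto_respStep_of_decays_rate` (from the END's `hKrate`),
  `abs_respStep_le_of_decays` + `summable_respStep_majorant` (from the END's `hK`), and **`SPerfOf_SDec_succ_of_decays_rate`**: the
  nesting at the limit with the weights `s₀⁻¹·Kinf y′ (Lc•z) (inl μ′) (inr μ)` — the limit resolvent's ℋ-column — under `hK`/`hKrate` + (HU) only.
NOT DONE HERE: the discharge of (HU) and of `hK`/`hKrate` themselves from (CONV-C) (row G-an2-4 / X1m-der); the m = 1 pin (owner's call, see `StationarityJ` header (b));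
which units `(rf, rm)` the suppliers use (the prefactor `Lc^{d+2}/(rf·rm)` is displayed, not chosen).
-/

namespace Summit.QuantumFields.BalabanUV.Beta.FP.StationarityJLimit

open Filter Topology Finset
open scoped BigOperators
open Literature.MathematicalPhysics.QuantumFieldTheory.Balaban1983to89
open Literature.MathematicalPhysics.QuantumFieldTheory.Balaban1983to89.Beta
open ExpKernelCalculus (MKer)
open HessKerRate (scaleK scaleK_apply)
open OneStepResolventKernel (Fib)
open OneStepKernelFamily (dec legSet legPt legW sum_legW legW_nonneg)
open InterLevelTransport (cwsum cwsum_apply transportV)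
open BalabanCompositeJets (Sc respStep)
open HessKerDressedLimit (limMKerOf limStOf limMKerOf_apply limStOf_apply limMKerOf_eq_of_tendsto)
open Summit.QuantumFields.BalabanUV.Beta.HessKerDressedUnits (legScale unitK unitS counitK unitK_apply counitK_apply unitS_apply
  abs_legScale_le)
open Summit.QuantumFields.BalabanUV.Beta.FP.StationarityK (unitK_mul legScale_mul dec_scaleK tendsto_dec_apply limStOf_succ)
open Summit.QuantumFields.BalabanUV.Beta.FP.StationarityJ (SDec SDec_succ_level decS decS_apply dec_apply dec_smul transportV_smul)
open Summit.QuantumFields.BalabanUV.Beta.FP.PerfectObjectsT (SPerfOf)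

variable {d : ℕ}

/-! ## §1 Units algebra; the transport does not see the bookkeeping blocking; decimation preserves entry bounds -/

section Units

/-- [folklore] Leg scalings commute with scalars. -/
theorem scaleK_smul (u v : Fib d → ℝ) (c : ℝ) (K : MKer (d + 1) (Fib d)) : scaleK u v (c • K) = c • scaleK u v K := by
  funext x y a b
  simp only [scaleK_apply, Pi.smul_apply, smul_eq_mul]
  ring

/-- [folklore] The contragredient units ARE the units at the inverse factors (definitional). -/
theorem counitK_eq_unitK (sf sm : ℝ) (V : MKer (d + 1) (Fib d)) : counitK sf sm V = unitK sf⁻¹ sm⁻¹ V := rfl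

/-- [folklore] Contragredient units compose: `counitK (rf·sf) (rm·sm) = counitK rf rm ∘ counitK sf sm`. -/
theorem counitK_mul (rf sf rm sm : ℝ) (V : MKer (d + 1) (Fib d)) :
    counitK (rf * sf) (rm * sm) V = counitK rf rm (counitK sf sm V) := by
  rw [counitK_eq_unitK, counitK_eq_unitK, counitK_eq_unitK, mul_inv, mul_inv, mul_comm rf⁻¹, mul_comm rm⁻¹, unitK_mul]

/-- [folklore] **UNITS OF A STENCIL TABLE COMPOSE**: `unitS (rf·sf) (rm·sm) S κ u = (rf·rm)⁻¹ • counitK rf rm (unitS sf sm S κ u)`. -/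
theorem unitS_mul (rf sf rm sm : ℝ) (S : Fin (d + 1) → (Fin (d + 1) → ℤ) → MKer (d + 1) (Fib d)) (κ : Fin (d + 1))
    (u : Fin (d + 1) → ℤ) : unitS (rf * sf) (rm * sm) S κ u = (rf * rm)⁻¹ • counitK rf rm (unitS sf sm S κ u) := by
  funext x y a b
  simp only [unitS_apply, counitK_apply, Pi.smul_apply, smul_eq_mul, mul_inv, legScale_mul]
  ring

/-- [folklore] Leg-type-constant units pass through the response transport (the weights do not see the legs). -/
theorem transportV_scaleK {N : ℕ} [NeZero N] (R : Fin (d + 1) → (Fin (d + 1) → ℤ) → Fin (d + 1) → (Fin (d + 1) → ℤ) → ℝ)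
    (p q : Fib d → ℝ) (𝒱 : Fin (d + 1) → (Fin (d + 1) → ℤ) → MKer (d + 1) (Fib d)) (μ : Fin (d + 1)) (z : Fin (d + 1) → ℤ) :
    transportV N R (fun μ' y' => scaleK p q (𝒱 μ' y')) μ z = scaleK p q (transportV N R 𝒱 μ z) := by
  funext x w a b
  rw [scaleK_apply]
  show ∑ μ' : Fin (d + 1), cwsum N (fun y' => R μ z μ' y') (fun y' => scaleK p q (𝒱 μ' y')) x w a b =
    p a * (∑ μ' : Fin (d + 1), cwsum N (fun y' => R μ z μ' y') (𝒱 μ') x w a b) * q b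
  rw [Finset.mul_sum, Finset.sum_mul]
  refine Finset.sum_congr rfl fun μ' _ => ?_
  rw [cwsum_apply, cwsum_apply, ← tsum_mul_left, ← tsum_mul_right]
  exact tsum_congr fun y' => by rw [scaleK_apply]; ring

/-- [folklore] `counitK` form of the previous lemma. -/
theorem transportV_counitK {N : ℕ} [NeZero N] (R : Fin (d + 1) → (Fin (d + 1) → ℤ) → Fin (d + 1) → (Fin (d + 1) → ℤ) → ℝ)
    (rf rm : ℝ) (𝒱 : Fin (d + 1) → (Fin (d + 1) → ℤ) → MKer (d + 1) (Fib d)) (μ : Fin (d + 1)) (z : Fin (d + 1) → ℤ) :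
    transportV N R (fun μ' y' => counitK rf rm (𝒱 μ' y')) μ z = counitK rf rm (transportV N R 𝒱 μ z) :=
  transportV_scaleK R _ _ 𝒱 μ z

/-- [folklore] **THE TRANSPORT DOES NOT SEE THE BOOKKEEPING BLOCKING**: `transportV N R 𝒱 μ z = transportV N′ R 𝒱 μ z` for nonzero `N, N′`
(both are `Σ_{μ′} Σ'_{y′} R μ z μ′ y′ · 𝒱 μ′ y′`, `InterLevelTransport.cwsum_apply`). -/
theorem transportV_indep (N N' : ℕ) [NeZero N] [NeZero N'] (R : Fin (d + 1) → (Fin (d + 1) → ℤ) → Fin (d + 1) → (Fin (d + 1) → ℤ) → ℝ)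
    (𝒱 : Fin (d + 1) → (Fin (d + 1) → ℤ) → MKer (d + 1) (Fib d)) (μ : Fin (d + 1)) (z : Fin (d + 1) → ℤ) :
    transportV N R 𝒱 μ z = transportV N' R 𝒱 μ z := by
  funext x w a b
  show ∑ μ' : Fin (d + 1), cwsum N (fun y' => R μ z μ' y') (𝒱 μ') x w a b =
    ∑ μ' : Fin (d + 1), cwsum N' (fun y' => R μ z μ' y') (𝒱 μ') x w a b
  exact Finset.sum_congr rfl fun μ' _ => by rw [cwsum_apply, cwsum_apply]

/-- [folklore] Entry formula of the transport: `transportV N R 𝒱 μ z x w a b = Σ_{μ′} Σ'_{y′} R μ z μ′ y′ · 𝒱 μ′ y′ x w a b`. -/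
theorem transportV_apply {N : ℕ} [NeZero N] (R : Fin (d + 1) → (Fin (d + 1) → ℤ) → Fin (d + 1) → (Fin (d + 1) → ℤ) → ℝ)
    (𝒱 : Fin (d + 1) → (Fin (d + 1) → ℤ) → MKer (d + 1) (Fib d)) (μ : Fin (d + 1)) (z : Fin (d + 1) → ℤ) (x w : Fin (d + 1) → ℤ)
    (a b : Fib d) : transportV N R 𝒱 μ z x w a b = ∑ μ' : Fin (d + 1), ∑' y', R μ z μ' y' * 𝒱 μ' y' x w a b := by
  show ∑ μ' : Fin (d + 1), cwsum N (fun y' => R μ z μ' y') (𝒱 μ') x w a b = _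
  exact Finset.sum_congr rfl fun μ' _ => cwsum_apply _ _ x w a b

/-- [folklore] **DECIMATION IS AN AVERAGE**: a uniform entry bound `|K x y a b| ≤ B` passes to `dec M K` (`M ≠ 0`; leg weights `≥ 0` summing to `1`). -/
theorem abs_dec_apply_le {M : ℕ} (hM : M ≠ 0) {K : MKer (d + 1) (Fib d)} {B : ℝ} (hK : ∀ x y a b, |K x y a b| ≤ B)
    (x' y' : Fin (d + 1) → ℤ) (a b : Fib d) : |dec M K x' y' a b| ≤ B := by
  rw [dec_apply]
  calc |∑ i ∈ legSet d M a, ∑ i' ∈ legSet d M b, legW d M a * legW d M b * K (legPt M a x' i) (legPt M b y' i') a b|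
      ≤ ∑ i ∈ legSet d M a, ∑ i' ∈ legSet d M b, |legW d M a * legW d M b * K (legPt M a x' i) (legPt M b y' i') a b| := by
        refine (Finset.abs_sum_le_sum_abs _ _).trans (Finset.sum_le_sum fun i _ => Finset.abs_sum_le_sum_abs _ _)
    _ ≤ ∑ i ∈ legSet d M a, ∑ i' ∈ legSet d M b, legW d M a * legW d M b * B := by
        refine Finset.sum_le_sum fun i _ => Finset.sum_le_sum fun i' _ => ?_
        rw [abs_mul, abs_mul, abs_of_nonneg (legW_nonneg M a), abs_of_nonneg (legW_nonneg M b)]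
        exact mul_le_mul_of_nonneg_left (hK _ _ a b) (mul_nonneg (legW_nonneg M a) (legW_nonneg M b))
    _ = B := by
        rw [Finset.sum_const, Finset.sum_const, nsmul_eq_mul, nsmul_eq_mul]
        have ha := sum_legW (d := d) hM a
        have hb := sum_legW (d := d) hM b
        rw [Finset.sum_const, nsmul_eq_mul] at ha hb
        calc ((legSet d M a).card : ℝ) * (((legSet d M b).card : ℝ) * (legW d M a * legW d M b * B))
            = (((legSet d M a).card : ℝ) * legW d M a) * (((legSet d M b).card : ℝ) * legW d M b) * B := by ring
          _ = B := by rw [ha, hb, one_mul, one_mul]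

/-- [folklore] Entry bound of a contragredient rescaling: `|counitK rf rm V x y a b| ≤ (max |rf⁻¹| |rm⁻¹|)²·B`. -/
theorem abs_counitK_apply_le (rf rm : ℝ) {V : MKer (d + 1) (Fib d)} {B : ℝ} (hV : ∀ x y a b, |V x y a b| ≤ B) (x y : Fin (d + 1) → ℤ)
    (a b : Fib d) : |counitK rf rm V x y a b| ≤ (max |rf⁻¹| |rm⁻¹|) ^ 2 * B := by
  have hB : 0 ≤ B := (abs_nonneg _).trans (hV x y a b)
  have hm : 0 ≤ max |rf⁻¹| |rm⁻¹| := le_max_of_le_left (abs_nonneg _)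
  rw [counitK_apply, abs_mul, abs_mul]
  calc |legScale rf⁻¹ rm⁻¹ a| * |V x y a b| * |legScale rf⁻¹ rm⁻¹ b|
      ≤ max |rf⁻¹| |rm⁻¹| * B * max |rf⁻¹| |rm⁻¹| := by
        apply mul_le_mul (mul_le_mul (abs_legScale_le _ _ a) (hV x y a b) (abs_nonneg _) hm) (abs_legScale_le _ _ b) (abs_nonneg _)
        positivity
    _ = (max |rf⁻¹| |rm⁻¹|) ^ 2 * B := by ring

end Units

/-! ## §2 The finite-level nesting in units -/

section FiniteUnits

variable {Lc : ℕ} [NeZero Lc] (hLc : 1 ≤ Lc) (cE cVH cΛ : ℝ) {sf sm : ℕ → ℝ} {rf rm : ℝ}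
  (hf : ∀ j, sf (j + 1) = rf * sf j) (hm : ∀ j, sm (j + 1) = rm * sm j)
include hLc hf hm

/-- [folklore] **`SDec_succ_level` IN GEOMETRIC UNITS**: the unit-rescaled (j+1, m) stencil is the transport, by the level-`j` one-step response,
of the once-more decimated unit-rescaled (j, m+1) stencil, re-read in the next units (`counitK rf rm`), times `Lc^{d+2}/(rf·rm)`. -/
theorem unitS_SDec_succ_level (j m : ℕ) (κ : Fin (d + 1)) (u : Fin (d + 1) → ℤ) :
    unitS (sf (j + 1)) (sm (j + 1)) (SDec d Lc cE cVH cΛ (j + 1) m) κ u =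
      (((Lc : ℝ) ^ (d + 2)) * (rf * rm)⁻¹) • transportV (Lc ^ j) (respStep (d := d) (Lc ^ j) (Lc ^ (j + 1)))
        (fun κ' u' => counitK rf rm (dec Lc (unitS (sf j) (sm j) (SDec d Lc cE cVH cΛ j (m + 1)) κ' u'))) κ u := by
  funext x w a b
  have hsf : (sf (j + 1))⁻¹ = rf⁻¹ * (sf j)⁻¹ := by rw [hf j, mul_inv]
  have hsm : (sm (j + 1))⁻¹ = rm⁻¹ * (sm j)⁻¹ := by rw [hm j, mul_inv]
  -- the transported entries, unfolded
  have eD : ∀ κ' u', (counitK rf rm (dec Lc (unitS (sf j) (sm j) (SDec d Lc cE cVH cΛ j (m + 1)) κ' u'))) x w a b =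
      (legScale rf⁻¹ rm⁻¹ a * legScale (sf j)⁻¹ (sm j)⁻¹ a * (sf j * sm j)⁻¹ * legScale (sf j)⁻¹ (sm j)⁻¹ b * legScale rf⁻¹ rm⁻¹ b) *
        dec Lc (SDec d Lc cE cVH cΛ j (m + 1) κ' u') x w a b := by
    intro κ' u'
    have e : unitS (sf j) (sm j) (SDec d Lc cE cVH cΛ j (m + 1)) κ' u' =
        (sf j * sm j)⁻¹ • scaleK (legScale (sf j)⁻¹ (sm j)⁻¹) (legScale (sf j)⁻¹ (sm j)⁻¹) (SDec d Lc cE cVH cΛ j (m + 1) κ' u') := rfl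
    rw [counitK_apply, e, dec_smul, dec_scaleK]
    simp only [Pi.smul_apply, smul_eq_mul, scaleK_apply]
    ring
  have key : ∀ κ', (∑' u', respStep (d := d) (Lc ^ j) (Lc ^ (j + 1)) κ u κ' u' *
      (counitK rf rm (dec Lc (unitS (sf j) (sm j) (SDec d Lc cE cVH cΛ j (m + 1)) κ' u'))) x w a b) =
      (legScale rf⁻¹ rm⁻¹ a * legScale (sf j)⁻¹ (sm j)⁻¹ a * (sf j * sm j)⁻¹ * legScale (sf j)⁻¹ (sm j)⁻¹ b * legScale rf⁻¹ rm⁻¹ b) *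
        ∑' u', respStep (d := d) (Lc ^ j) (Lc ^ (j + 1)) κ u κ' u' * dec Lc (SDec d Lc cE cVH cΛ j (m + 1) κ' u') x w a b := by
    intro κ'
    rw [← tsum_mul_left]
    exact tsum_congr fun u' => by rw [eD]; ring
  rw [unitS_apply, SDec_succ_level hLc cE cVH cΛ j m κ u]
  simp only [Pi.smul_apply, smul_eq_mul, transportV_apply, decS_apply, key, ← Finset.mul_sum, mul_inv, hsf, hsm, legScale_mul]
  ring

end FiniteUnits

/-! ## §3 Tannery for the response transport -/

section Tannery

/-- [folklore] The constructed limit of a convergent entry sequence is its limit (uniqueness of limits in `ℝ`). -/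
theorem tendsto_limMKerOf_apply_of_exists {D : ℕ} {F : Type*} {K : ℕ → MKer D F}
    (h : ∀ x y a b, ∃ L : ℝ, Tendsto (fun j => K j x y a b) atTop (𝓝 L)) (x y : Fin D → ℤ) (a b : F) :
    Tendsto (fun j => K j x y a b) atTop (𝓝 (limMKerOf K x y a b)) := by
  obtain ⟨L, hL⟩ := h x y a b
  rw [limMKerOf_apply, RateCertificate.CauchyRate.lim, hL.limUnder_eq]
  exact hL

/-- [folklore] **TANNERY FOR THE TRANSPORT.**  Weights converging pointwise under a `j`-uniform summable majorant, transported family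
converging entrywise under a `j`-uniform bound ⟹ the transport converges entrywise (`tendsto_tsum_of_dominated_convergence` per `μ′`,
then a finite sum). -/
theorem tendsto_transportV_apply {N : ℕ} [NeZero N]
    {ρ : ℕ → Fin (d + 1) → (Fin (d + 1) → ℤ) → Fin (d + 1) → (Fin (d + 1) → ℤ) → ℝ}
    {ρinf : Fin (d + 1) → (Fin (d + 1) → ℤ) → Fin (d + 1) → (Fin (d + 1) → ℤ) → ℝ}
    {T : ℕ → Fin (d + 1) → (Fin (d + 1) → ℤ) → MKer (d + 1) (Fib d)} {Tinf : Fin (d + 1) → (Fin (d + 1) → ℤ) → MKer (d + 1) (Fib d)}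
    {g : Fin (d + 1) → (Fin (d + 1) → ℤ) → Fin (d + 1) → (Fin (d + 1) → ℤ) → ℝ} {B : ℝ}
    (hg : ∀ μ z μ', Summable (g μ z μ')) (hρb : ∀ j μ z μ' y', |ρ j μ z μ' y'| ≤ g μ z μ' y')
    (hρ : ∀ μ z μ' y', Tendsto (fun j => ρ j μ z μ' y') atTop (𝓝 (ρinf μ z μ' y')))
    (hTb : ∀ j μ' y' x w a b, |T j μ' y' x w a b| ≤ B)
    (hT : ∀ μ' y' x w a b, Tendsto (fun j => T j μ' y' x w a b) atTop (𝓝 (Tinf μ' y' x w a b)))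
    (μ : Fin (d + 1)) (z x w : Fin (d + 1) → ℤ) (a b : Fib d) :
    Tendsto (fun j => transportV N (ρ j) (T j) μ z x w a b) atTop (𝓝 (transportV N ρinf Tinf μ z x w a b)) := by
  have hB : 0 ≤ B := (abs_nonneg _).trans (hTb 0 0 0 0 0 a b)
  simp only [transportV_apply]
  refine tendsto_finsetSum _ fun μ' _ => ?_
  refine tendsto_tsum_of_dominated_convergence (bound := fun y' => g μ z μ' y' * B) ((hg μ z μ').mul_right B)
    (fun y' => (hρ μ z μ' y').mul (hT μ' y' x w a b)) (Eventually.of_forall fun j y' => ?_)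
  rw [Real.norm_eq_abs, abs_mul]
  exact mul_le_mul (hρb j μ z μ' y') (hTb j μ' y' x w a b) (abs_nonneg _) ((abs_nonneg _).trans (hρb j μ z μ' y'))

end Tannery

/-! ## §4 N1-J at the limit: the perfect first-order jets nest -/

section Limit

variable {Lc : ℕ} [NeZero Lc] (hLc : 1 ≤ Lc) (cE cVH cΛ : ℝ) {sf sm : ℕ → ℝ} {rf rm : ℝ}
  (hf : ∀ j, sf (j + 1) = rf * sf j) (hm : ∀ j, sm (j + 1) = rm * sm j)
include hLc hf hm

/-- [folklore] **N1-J AT THE LIMIT — THE PERFECT FIRST-ORDER JETS NEST.**  Geometric units; (HR) the one-step response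
`respStep (Lc^j) (Lc^(j+1))` converges pointwise to `ρ∞` under a `j`-uniform summable majorant `g`; (HU) the unit-rescaled (j, m+1) family
`unitS (sf j) (sm j) (SDec j (m+1))` converges entrywise (X1m) under a `j`-uniform entry bound `B`.  THEN
`SPerfOf sf sm SDec m κ u = (Lc^{d+2}·(rf·rm)⁻¹) • transportV 1 ρ∞ (fun κ′ u′ => counitK rf rm (dec Lc (SPerfOf sf sm SDec (m+1) κ′ u′))) κ u`. -/
theorem SPerfOf_SDec_succ
    {ρinf : Fin (d + 1) → (Fin (d + 1) → ℤ) → Fin (d + 1) → (Fin (d + 1) → ℤ) → ℝ}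
    {g : Fin (d + 1) → (Fin (d + 1) → ℤ) → Fin (d + 1) → (Fin (d + 1) → ℤ) → ℝ} {B : ℝ}
    (hg : ∀ μ z μ', Summable (g μ z μ'))
    (hRb : ∀ j μ z μ' y', |respStep (d := d) (Lc ^ j) (Lc ^ (j + 1)) μ z μ' y'| ≤ g μ z μ' y')
    (hR : ∀ μ z μ' y', Tendsto (fun j => respStep (d := d) (Lc ^ j) (Lc ^ (j + 1)) μ z μ' y') atTop (𝓝 (ρinf μ z μ' y')))
    (m : ℕ)
    (hUb : ∀ j κ' u' x w a b, |unitS (sf j) (sm j) (SDec d Lc cE cVH cΛ j (m + 1)) κ' u' x w a b| ≤ B)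
    (hU : ∀ κ' u' x w a b, ∃ L : ℝ, Tendsto (fun j => unitS (sf j) (sm j) (SDec d Lc cE cVH cΛ j (m + 1)) κ' u' x w a b) atTop (𝓝 L))
    (κ : Fin (d + 1)) (u : Fin (d + 1) → ℤ) :
    SPerfOf sf sm (SDec d Lc cE cVH cΛ) m κ u =
      (((Lc : ℝ) ^ (d + 2)) * (rf * rm)⁻¹) • transportV 1 ρinf
        (fun κ' u' => counitK rf rm (dec Lc (SPerfOf sf sm (SDec d Lc cE cVH cΛ) (m + 1) κ' u'))) κ u := by
  have hLc0 : Lc ≠ 0 := NeZero.ne Lc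
  -- (HU) ⇒ entrywise convergence of the (j, m+1) family TO the perfect member m+1
  have hUlim : ∀ κ' u' x w a b, Tendsto (fun j => unitS (sf j) (sm j) (SDec d Lc cE cVH cΛ j (m + 1)) κ' u' x w a b) atTop
      (𝓝 (SPerfOf sf sm (SDec d Lc cE cVH cΛ) (m + 1) κ' u' x w a b)) := by
    intro κ' u' x w a b
    have e : SPerfOf sf sm (SDec d Lc cE cVH cΛ) (m + 1) κ' u' =
        limMKerOf (fun j => unitS (sf j) (sm j) (SDec d Lc cE cVH cΛ j (m + 1)) κ' u') := rfl
    rw [e]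
    exact tendsto_limMKerOf_apply_of_exists (K := fun j => unitS (sf j) (sm j) (SDec d Lc cE cVH cΛ j (m + 1)) κ' u')
      (fun x w a b => hU κ' u' x w a b) x w a b
  -- the transported families and their limit, bounds
  set T : ℕ → Fin (d + 1) → (Fin (d + 1) → ℤ) → MKer (d + 1) (Fib d) :=
    fun j κ' u' => counitK rf rm (dec Lc (unitS (sf j) (sm j) (SDec d Lc cE cVH cΛ j (m + 1)) κ' u')) with hT
  set Tinf : Fin (d + 1) → (Fin (d + 1) → ℤ) → MKer (d + 1) (Fib d) :=
    fun κ' u' => counitK rf rm (dec Lc (SPerfOf sf sm (SDec d Lc cE cVH cΛ) (m + 1) κ' u')) with hTinf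
  have hTb : ∀ j κ' u' x w a b, |T j κ' u' x w a b| ≤ (max |rf⁻¹| |rm⁻¹|) ^ 2 * B := fun j κ' u' x w a b =>
    abs_counitK_apply_le rf rm (abs_dec_apply_le hLc0 (hUb j κ' u')) x w a b
  have hTlim : ∀ κ' u' x w a b, Tendsto (fun j => T j κ' u' x w a b) atTop (𝓝 (Tinf κ' u' x w a b)) := by
    intro κ' u' x w a b
    simp only [hT, hTinf, counitK_apply]
    exact ((tendsto_dec_apply (hUlim κ' u') Lc x w a b).const_mul _).mul_const _
  -- the index shift: the perfect member m is the constructed limit of the SHIFTED unit-rescaled family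
  have eL : SPerfOf sf sm (SDec d Lc cE cVH cΛ) m κ u =
      limMKerOf (fun j => unitS (sf (j + 1)) (sm (j + 1)) (SDec d Lc cE cVH cΛ (j + 1) m) κ u) := by
    have e : SPerfOf sf sm (SDec d Lc cE cVH cΛ) m = limStOf (fun j => unitS (sf j) (sm j) (SDec d Lc cE cVH cΛ j m)) := rfl
    rw [e, ← limStOf_succ (fun j => unitS (sf j) (sm j) (SDec d Lc cE cVH cΛ j m)), limStOf_apply]
  rw [eL]
  -- every shifted member is the transport of `T j` (finite nesting in units), with the bookkeeping blocking replaced by `1`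
  have eF : (fun j => unitS (sf (j + 1)) (sm (j + 1)) (SDec d Lc cE cVH cΛ (j + 1) m) κ u) =
      fun j => (((Lc : ℝ) ^ (d + 2)) * (rf * rm)⁻¹) • transportV 1 (respStep (d := d) (Lc ^ j) (Lc ^ (j + 1))) (T j) κ u := by
    funext j
    rw [unitS_SDec_succ_level hLc cE cVH cΛ hf hm j m κ u, transportV_indep (Lc ^ j) 1]
  rw [eF]
  -- dominated convergence
  refine limMKerOf_eq_of_tendsto fun x w a b => ?_
  simp only [Pi.smul_apply, smul_eq_mul]
  exact (tendsto_transportV_apply (N := 1) hg hRb hR hTb hTlim κ u x w a b).const_mul _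

end Limit

/-! ## §5 (HR) in the road's own X1 currency: matched units `sf j · sm j = s₀ · (Lc^j)^{d+2}` -/

section Matched

variable {Lc : ℕ} [NeZero Lc]

/-- [folklore] **THE ONE-STEP RESPONSE IS THE UNIT-RESCALED STEP RESOLVENT'S `(inl, inr)` ENTRY** when the units are matched to the sum
normalisation, `sf j · sm j = s₀ · (Lc^j)^{d+2}`: `respStep (Lc^j) (Lc^(j+1)) μ z μ′ y′ = s₀⁻¹ · unitK (sf j) (sm j) (KInvStep Lc j) y′ (Lc•z) (inl μ′) (inr μ)`
(`BalabanCompositeJets.respStep_eq`). -/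
theorem respStep_eq_unitK_KInvStep {sf sm : ℕ → ℝ} {s₀ : ℝ} (hs : ∀ j, sf j * sm j = s₀ * (((Lc ^ j : ℕ) : ℝ) ^ (d + 2)))
    (hs0 : s₀ ≠ 0) (j : ℕ) (μ : Fin (d + 1)) (z : Fin (d + 1) → ℤ) (μ' : Fin (d + 1)) (y' : Fin (d + 1) → ℤ) :
    respStep (d := d) (Lc ^ j) (Lc ^ (j + 1)) μ z μ' y' =
      s₀⁻¹ * unitK (sf j) (sm j) (OneStepKernelFamily.KInvStep (d := d) Lc j) y' ((Lc : ℤ) • z) (Sum.inl μ') (Sum.inr μ) := by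
  rw [BalabanCompositeJets.respStep_eq Lc j μ z μ' y', unitK_apply,
    Summit.QuantumFields.BalabanUV.Beta.HessKerDressedUnits.legScale_inl,
    Summit.QuantumFields.BalabanUV.Beta.HessKerDressedUnits.legScale_inr]
  have e : sf j * OneStepKernelFamily.KInvStep (d := d) Lc j y' ((Lc : ℤ) • z) (Sum.inl μ') (Sum.inr μ) * sm j =
      (sf j * sm j) * OneStepKernelFamily.KInvStep (d := d) Lc j y' ((Lc : ℤ) • z) (Sum.inl μ') (Sum.inr μ) := by ring
  rw [e, hs j, ← mul_assoc, ← mul_assoc, inv_mul_cancel₀ hs0, one_mul]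

/-- [folklore] **(HR), CONVERGENCE HALF, FROM THE ROAD'S `hKrate`** (matched units): the one-step response converges pointwise to `s₀⁻¹·`
the named limit's `(inl, inr)` entry. -/
theorem tendsto_respStep_of_decays_rate {sf sm : ℕ → ℝ} {s₀ : ℝ} (hs : ∀ j, sf j * sm j = s₀ * (((Lc ^ j : ℕ) : ℝ) ^ (d + 2)))
    (hs0 : s₀ ≠ 0) {Kinf : MKer (d + 1) (Fib d)} {c δ θ : ℝ}
    (hKrate : ∀ k, ExpKernelCalculus.Decays (unitK (sf k) (sm k) (OneStepKernelFamily.KInvStep (d := d) Lc k) - Kinf) (c * θ ^ k) δ)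
    (hθ0 : 0 ≤ θ) (hθ1 : θ < 1) (μ : Fin (d + 1)) (z : Fin (d + 1) → ℤ) (μ' : Fin (d + 1)) (y' : Fin (d + 1) → ℤ) :
    Tendsto (fun j => respStep (d := d) (Lc ^ j) (Lc ^ (j + 1)) μ z μ' y') atTop
      (𝓝 (s₀⁻¹ * Kinf y' ((Lc : ℤ) • z) (Sum.inl μ') (Sum.inr μ))) := by
  have h := (HessKerDressedLimit.tendsto_of_decays_rate hKrate hθ0 hθ1 y' ((Lc : ℤ) • z) (Sum.inl μ') (Sum.inr μ)).const_mul s₀⁻¹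
  refine h.congr' (Eventually.of_forall fun j => ?_)
  exact (respStep_eq_unitK_KInvStep hs hs0 j μ z μ' y').symm

/-- [folklore] **(HR), DOMINATION HALF, FROM THE ROAD'S `hK`** (matched units): a `j`-uniform `Decays` bound of the unit-rescaled step
resolvent gives the `j`-uniform majorant `|respStep …| ≤ |s₀⁻¹|·C·e^{−δ|y′ − Lc•z|₁}`, summable in `y′`. -/
theorem abs_respStep_le_of_decays {sf sm : ℕ → ℝ} {s₀ : ℝ} (hs : ∀ j, sf j * sm j = s₀ * (((Lc ^ j : ℕ) : ℝ) ^ (d + 2)))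
    (hs0 : s₀ ≠ 0) {C δ : ℝ} (hK : ∀ j, ExpKernelCalculus.Decays (unitK (sf j) (sm j) (OneStepKernelFamily.KInvStep (d := d) Lc j)) C δ)
    (j : ℕ) (μ : Fin (d + 1)) (z : Fin (d + 1) → ℤ) (μ' : Fin (d + 1)) (y' : Fin (d + 1) → ℤ) :
    |respStep (d := d) (Lc ^ j) (Lc ^ (j + 1)) μ z μ' y'| ≤
      |s₀⁻¹| * C * Real.exp (-δ * Literature.MathematicalPhysics.QuantumFieldTheory.Balaban1983to89.B12Sec2to5.l1 (y' - (Lc : ℤ) • z)) := by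
  rw [respStep_eq_unitK_KInvStep hs hs0 j μ z μ' y', abs_mul, mul_assoc]
  exact mul_le_mul_of_nonneg_left (hK j y' ((Lc : ℤ) • z) (Sum.inl μ') (Sum.inr μ)) (abs_nonneg _)

omit [NeZero Lc] in
/-- [folklore] The majorant is summable in `y′` (`ExpKernelCalculus.summable_exp_shift`, `ℓ¹` symmetry). -/
theorem summable_respStep_majorant {s₀ C δ : ℝ} (hδ : 0 < δ) (z : Fin (d + 1) → ℤ) :
    Summable fun y' : Fin (d + 1) → ℤ =>
      |s₀⁻¹| * C * Real.exp (-δ * Literature.MathematicalPhysics.QuantumFieldTheory.Balaban1983to89.B12Sec2to5.l1 (y' - (Lc : ℤ) • z)) := by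
  have h := (ExpKernelCalculus.summable_exp_shift (D := d + 1) hδ ((Lc : ℤ) • z)).mul_left (|s₀⁻¹| * C)
  refine h.congr fun y' => ?_
  rw [ExpKernelCalculus.l1_sub_symm]

variable (hLc : 1 ≤ Lc) (cE cVH cΛ : ℝ) {sf sm : ℕ → ℝ} {rf rm : ℝ}
  (hf : ∀ j, sf (j + 1) = rf * sf j) (hm : ∀ j, sm (j + 1) = rm * sm j)
include hLc hf hm

/-- [folklore] **N1-J AT THE LIMIT IN THE ROAD'S OWN CURRENCY.**  Geometric units MATCHED to the sum normalisation (`sf j·sm j = s₀·(Lc^j)^{d+2}`,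
`s₀ ≠ 0`); the END's own X1 data on the step resolvent — `hK` (a `j`-uniform `Decays` bound of `unitK (sf j) (sm j) (KInvStep Lc j)`) and
`hKrate` (rate to a named limit `Kinf`, `0 ≤ θ < 1`); and (HU) (X1m) for the (j, m+1) stencil family.  THEN the perfect first-order jets nest
THROUGH THE LIMIT RESOLVENT'S ℋ-COLUMN: `SPerfOf sf sm SDec m κ u = (Lc^{d+2}·(rf·rm)⁻¹) • transportV 1 (fun μ z μ′ y′ => s₀⁻¹·Kinf y′ (Lc•z)
(inl μ′) (inr μ)) (fun κ′ u′ => counitK rf rm (dec Lc (SPerfOf sf sm SDec (m+1) κ′ u′))) κ u` (matched geometric units force `rf·rm = Lc^{d+2}`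
whenever `sf 0·sm 0 ≠ 0`, so the displayed prefactor is then `1`; it is kept symbolic here). -/
theorem SPerfOf_SDec_succ_of_decays_rate {s₀ : ℝ} (hs : ∀ j, sf j * sm j = s₀ * (((Lc ^ j : ℕ) : ℝ) ^ (d + 2))) (hs0 : s₀ ≠ 0)
    {Kinf : MKer (d + 1) (Fib d)} {C c δ θ : ℝ} (hδ : 0 < δ)
    (hK : ∀ j, ExpKernelCalculus.Decays (unitK (sf j) (sm j) (OneStepKernelFamily.KInvStep (d := d) Lc j)) C δ)
    (hKrate : ∀ k, ExpKernelCalculus.Decays (unitK (sf k) (sm k) (OneStepKernelFamily.KInvStep (d := d) Lc k) - Kinf) (c * θ ^ k) δ)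
    (hθ0 : 0 ≤ θ) (hθ1 : θ < 1) (m : ℕ) {B : ℝ}
    (hUb : ∀ j κ' u' x w a b, |unitS (sf j) (sm j) (SDec d Lc cE cVH cΛ j (m + 1)) κ' u' x w a b| ≤ B)
    (hU : ∀ κ' u' x w a b, ∃ L : ℝ, Tendsto (fun j => unitS (sf j) (sm j) (SDec d Lc cE cVH cΛ j (m + 1)) κ' u' x w a b) atTop (𝓝 L))
    (κ : Fin (d + 1)) (u : Fin (d + 1) → ℤ) :
    SPerfOf sf sm (SDec d Lc cE cVH cΛ) m κ u =
      (((Lc : ℝ) ^ (d + 2)) * (rf * rm)⁻¹) • transportV 1 (fun μ z μ' y' => s₀⁻¹ * Kinf y' ((Lc : ℤ) • z) (Sum.inl μ') (Sum.inr μ))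
        (fun κ' u' => counitK rf rm (dec Lc (SPerfOf sf sm (SDec d Lc cE cVH cΛ) (m + 1) κ' u'))) κ u :=
  SPerfOf_SDec_succ hLc cE cVH cΛ hf hm (fun _ z _ => summable_respStep_majorant (Lc := Lc) (s₀ := s₀) (C := C) hδ z)
    (fun j μ z μ' y' => abs_respStep_le_of_decays hs hs0 hK j μ z μ' y')
    (fun μ z μ' y' => tendsto_respStep_of_decays_rate hs hs0 hKrate hθ0 hθ1 μ z μ' y') m hUb hU κ u

end Matched

end Summit.QuantumFields.BalabanUV.Beta.FP.StationarityJLimit
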